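import Literature.MathematicalPhysics.QuantumFieldTheory.Balaban1983to89.NodeOLetters
import Literature.MathematicalPhysics.QuantumFieldTheory.Balaban1983to89.B13Sqrt27Accretive

/-!
# `Balaban1983to89.NodeOLettersSqrt` — NODE O's letter interface `NodeOLetters.KernelLetters` (L1)–(L3) FOR THE SQUARE-ROOT FAMILY
# `(σ,u) ↦ (P(σ,u))^{−1/2}` of [Balaban1988RG2Cluster] (2.7) p. 13 ∕ p. 15, REDUCED to precision-level letters: uniform accretivity, range one and
# off-diagonal sums, the (L2)-type σ-localisation OF THE PRECISION through `X`, and its entrywise `u`-holomorphy — a by-name junction of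
# dag-n10-b's `B13Sqrt27Accretive` (the finite-matrix theorems) into ym-nodeO-ideate's `NodeOLetters` (the walk-free interface of NODE O)

statement-level bookkeeping over published theorems with citation tags; kernel-checked compositions of tree theorems; nothing here is a claim about
the Yang–Mills mass gap.

Cell `pub-ymgap`, YM-PLAN Track A (HUMAN RULING D-0062), node N10 = [Balaban1988RG2Cluster] Lemmas 1–3; seat `pub-ymgap-dag-p2` = n10-a (KNIT-BY-NAME),
generation 6, module 4; the -b seat's hand-over (dag-n10-b g2, `B13Sqrt27Accretive` p422202, bus [DAGN10B-G2-FILED-1]: «BY-NAME for the S-factor of the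
(2.14) Γ-kernel: `norm_invSqrt_apply_le` (L1), `norm_invSqrt_sub_apply_le` (L2 ∕ (2.16)-type), `differentiableOn_invSqrt_apply` (L3)»).  FLAG item (B1) of
the N10 residual (director-ym LINE: Lemma 3 (2.38) majorant = NODE A ∕ O) in the BACKGROUND direction `u`: the tree's NODE-O interface theorem
`NodeOLetters.termWalkData_of_letters` ∕ `acrossSmall_of_letters` asks, per (2.14)-term, for the letters (L1)–(L3) of the Γ-kernel `Γ_k(Z₀,σ,𝐔,𝐉) =
C*Δ_k(σ)C_{Z₀ᶜ}(C^{(k)})^{1/2}(σ)` and of the precision; this file supplies (L1)–(L3) for the `(C^{(k)})^{1/2}`-FACTOR from letters of the PRECISION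
`P = C*Δ_kC` ITSELF (whose accretivity with k-uniform `(m, h)` and whose own letters are object-level content of the in-edge [13] = G-B9-10 and of NODE 00's
pin — untouched here; the σ-POLYDISC smallness `O(1)e^{−⅓δ₀M}` of (2.16) through walks is NOT treated, exactly as in `B13Sqrt27Accretive`).

CITATION.  [Balaban1988RG2Cluster] p. 13 (2.7): *"(C^{(k)})^{1/2} = (C\*Δ_kC)^{−1/2} = (1/π)∫₀^∞ dx x^{−1/2}(xI + C\*Δ_kC)^{−1} … The operator G̃₃(x) has
the same properties as G̃₂, especially it can be expanded into a generalized random walk expansion. This yields an expansion of the integral above, hence an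
expansion of (C^{(k)})^{1/2} also."*; p. 15: *"The general case is handled by a perturbative argument."*; p. 16 (2.16).  [Balaban1985BackgroundPropagators]
(3.93) p. 410 (the distance through a region), Thm 3.10 p. 416.

WHAT THIS FILE PROVES (0 `sorry`, 0 `def`, standard axioms).
§1 `distX_le_inf`, `distX_le_tdist1_add` — the inf-convolution distance `d_X` of `NodeOLetters` is dominated THROUGH any pair of intermediate points:
   `d_X(a,b) ≤ d₁(a,a′) + d_X(a′,b′) + d₁(b′,b)` (the «through-domination» hypothesis `hD` of `B13Sqrt27Accretive.norm_mul_mul_apply_le_through` ∕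
   `norm_invSqrt_sub_apply_le` for the weight `D := d_X(loc ·, loc ·)∕s`).
§2 **`kernelLetters_invSqrt`** — for a precision family `P : (TPt d N' → ℂ) → E → Matrix Λ Λ ℂ` on bonds located by `locΛ : Λ → UT Nf`, with an ℕ-valued
   range-one pseudo-metric `dist` on `Λ` dominating the located torus distance (`d₁(loc i, loc j) ≤ s·dist i j`, `s > 0` = the lattice scale), and UNIFORMLY on
   the polydisc `‖σ_j‖ ≤ e^{κ₁}` × the ball `‖u‖ < R` (`R > 0`): `m`-accretive (`m > 0`), off-diagonal row ∕ column sums `≤ h`, `h(e^θ − 1) ≤ m∕2`; the (L2)-type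
   σ-localisation of `P` through `X` at the reference `‖(P(σ,0) − P(0,0))_{kl}‖ ≤ B₀e^{−ρ₀ d_X(loc k, loc l)}`; entrywise `u`-holomorphy of `P(σ,·)`; volume
   sums `Σ_k e^{−η dist(i,k)} ≤ c_V`; rates `0 ≤ θ′ ≤ ρ₀ s`, `θ′ + η ≤ θ`, `η ≥ 0` ⟹
   `KernelLetters c locΛ locΛ (fun σ u => invSqrt (P σ u)) X R (θ′∕s) (2∕√m) (4B₀c_V²∕(m√m))`.
   So NODE O's three letters for the square-root factor cost nothing beyond the precision's own letters and accretivity.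
§3 **`kernelLetters_mul`** — letters (L1)–(L3) of a PRODUCT `K₁K₂` of two letter-carrying families through the same `X` (rate `ρ′` with `ρ′ + η ≤ ρ`,
   amplitudes `B₁B₂c_V` and `(B₁′B₂ + B₁B₂′)c_V`, volume sums `c_V` on the middle index set): with §2, the Γ-kernel read as «local factor × square root of the
   covariance» (p. 13) inherits NODE O's letters from the local factor's and the precision's.

HONEST FRAMING (dag-lead DEDUP №28 rails, verbatim): «the letters INTERFACE typed for `(σ,u) ↦ invSqrt (P σ u)` from precision-level letters; NODE O = N25
itself untouched and unstaffed under D-0062; σ-polydisc analyticity of the Γ-kernel is NOT asserted».  Finite-matrix bookkeeping joining two tree interfaces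
by name; nothing of Bałaban's `Δ_k`, `C^{(k)}`, `Γ_k` is constructed or asserted;
whether HIS precision is accretive ∕ localised ∕ holomorphic with scale-uniform constants is the in-edge's and the pin's content; count-neutral; one finite
four-torus programme; nothing continuum ∕ ℝ⁴ ∕ OS ∕ mass-gap ∕ Clay.
-/

noncomputable section

namespace Literature.MathematicalPhysics.QuantumFieldTheory.Balaban1983to89.NodeOLettersSqrt

open Metric Set Finset
open scoped Matrix
open Literature.MathematicalPhysics.QuantumFieldTheory.Balaban1983to89
open Literature.MathematicalPhysics.QuantumFieldTheory.Balaban1983to89.B9Thm37GlueTorus (tdist1 tdist1_nonneg tdist1_triangle)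
open Literature.MathematicalPhysics.QuantumFieldTheory.Balaban1983to89.TreeLengthTorus (TPt)
open Literature.MathematicalPhysics.QuantumFieldTheory.Balaban1983to89.B5TorusCover (UT)
open Literature.MathematicalPhysics.QuantumFieldTheory.Balaban1983to89.NodeOLetters (distX distX_eq distX_nonneg KernelLetters)
open Literature.MathematicalPhysics.QuantumFieldTheory.Balaban1983to89.B13Sqrt27Accretive
  (invSqrt norm_invSqrt_apply_le norm_invSqrt_sub_apply_le differentiableOn_invSqrt_apply)

variable {d N' : ℕ} {ν : ℕ} {Nf : Fin ν → ℕ} [∀ i, NeZero (Nf i)]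

/-! ## §1 The distance through `X` is dominated through intermediate points -/

/-- `d_X(a,b) ≤ d₁(a,z) + d₁(z,b)` for every `z ∈ X` (the infimum is below each value). [cite: Balaban1985BackgroundPropagators, (3.93) p.410] -/
theorem distX_le_inf {X : Finset (UT Nf)} {z : UT Nf} (hz : z ∈ X) (a b : UT Nf) :
    distX X a b ≤ tdist1 Nf a z + tdist1 Nf z b := by
  have hX : X.Nonempty := ⟨z, hz⟩
  show (if h : X.Nonempty then X.inf' h (fun z => tdist1 Nf a z + tdist1 Nf z b) else 0) ≤ _
  rw [dif_pos hX]
  exact Finset.inf'_le _ hz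

/-- **Through-domination of `d_X`**: `d_X(a,b) ≤ d₁(a,a′) + d_X(a′,b′) + d₁(b′,b)` (`X ≠ ∅`; two triangle inequalities at the minimiser of `d_X(a′,b′)`) —
the shape `hD` of `B13Sqrt27Accretive.norm_invSqrt_sub_apply_le`. [cite: Balaban1985BackgroundPropagators, (3.93) p.410] -/
theorem distX_le_tdist1_add {X : Finset (UT Nf)} (hX : X.Nonempty) (a a' b' b : UT Nf) :
    distX X a b ≤ tdist1 Nf a a' + distX X a' b' + tdist1 Nf b' b := by
  obtain ⟨z, hz, h⟩ := distX_eq hX a' b'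
  calc distX X a b ≤ tdist1 Nf a z + tdist1 Nf z b := distX_le_inf hz a b
    _ ≤ (tdist1 Nf a a' + tdist1 Nf a' z) + (tdist1 Nf z b' + tdist1 Nf b' b) :=
        add_le_add (tdist1_triangle a a' z) (tdist1_triangle z b' b)
    _ = tdist1 Nf a a' + (tdist1 Nf a' z + tdist1 Nf z b') + tdist1 Nf b' b := by ring
    _ = tdist1 Nf a a' + distX X a' b' + tdist1 Nf b' b := by rw [h]

/-! ## §2 The letters (L1)–(L3) of the square-root family from precision-level letters -/

variable {Λ : Type} [Fintype Λ] [DecidableEq Λ]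
variable {E : Type*} [NormedAddCommGroup E] [NormedSpace ℂ E]

omit [∀ i, NeZero (Nf i)] in
/-- `σ = 0` lies in the polydisc `‖σ_j‖ ≤ e^{κ₁}` (plumbing). [folklore] -/
private theorem zero_mem_polydisc (c : B13.Consts) : ∀ j, ‖(0 : TPt d N' → ℂ) j‖ ≤ Real.exp c.κ₁ :=
  fun _ => by simpa using (Real.exp_pos c.κ₁).le

/-- **NODE O's LETTERS (L1)–(L3) FOR THE SQUARE-ROOT FAMILY `(σ,u) ↦ (P(σ,u))^{−1/2}`, FROM THE PRECISION's LETTERS.**  Hypotheses, uniformly on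
polydisc × ball: `P(σ,u)` is `m`-accretive with range one and off-diagonal row ∕ column sums `≤ h` in an ℕ-valued pseudo-metric `dist` on the row bonds that
dominates the located torus distance (`d₁(loc i, loc j) ≤ s·dist i j`); `h(e^θ − 1) ≤ m∕2`; `P(σ,0) − P(0,0)` is σ-localised through `X` at rate `ρ₀`, amplitude
`B₀`; `P(σ,·)` is entrywise holomorphic on the ball; volume sums at rate `η`.  Conclusion: decay (L1) at rate `θ′∕s` with amplitude `2∕√m`
(`norm_invSqrt_apply_le`), σ-localisation (L2) through `X` at the same rate with amplitude `4B₀c_V²∕(m√m)` (`norm_invSqrt_sub_apply_le` with the weight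
`d_X(loc ·, loc ·)∕s`, through-dominated by §1), holomorphy (L3) (`differentiableOn_invSqrt_apply`).
[cite: Balaban1988RG2Cluster, (2.7) p.13, p.15, (2.16) p.16; Balaban1985BackgroundPropagators, Thm 3.10 p.416] -/
theorem kernelLetters_invSqrt (c : B13.Consts) (locΛ : Λ → UT Nf) {X : Finset (UT Nf)} (hX : X.Nonempty)
    (P : (TPt d N' → ℂ) → E → Matrix Λ Λ ℂ)
    (dist : Λ → Λ → ℕ) (hd0 : ∀ i, dist i i = 0) (hds : ∀ i j, dist i j = dist j i)
    (hdt : ∀ i j k, dist i k ≤ dist i j + dist j k)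
    {s : ℝ} (hs : 0 < s) (hloc : ∀ i j, tdist1 Nf (locΛ i) (locΛ j) ≤ s * dist i j)
    {R h m θ η cV B₀ ρ₀ θ' : ℝ} (hR : 0 < R) (hm : 0 < m) (hθ : 0 ≤ θ) (hhθ : h * (Real.exp θ - 1) ≤ m / 2)
    (hη : 0 ≤ η) (hB₀ : 0 ≤ B₀) (hθ' : 0 ≤ θ') (hθ'ρ : θ' ≤ ρ₀ * s) (hθ'η : θ' + η ≤ θ)
    (hrange : ∀ σ : TPt d N' → ℂ, (∀ j, ‖σ j‖ ≤ Real.exp c.κ₁) → ∀ u ∈ ball (0 : E) R,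
      ∀ i j, P σ u i j ≠ 0 → dist i j ≤ 1)
    (hrow : ∀ σ : TPt d N' → ℂ, (∀ j, ‖σ j‖ ≤ Real.exp c.κ₁) → ∀ u ∈ ball (0 : E) R,
      ∀ i, ∑ j ∈ univ.filter (fun j => dist i j ≠ 0), ‖P σ u i j‖ ≤ h)
    (hcol : ∀ σ : TPt d N' → ℂ, (∀ j, ‖σ j‖ ≤ Real.exp c.κ₁) → ∀ u ∈ ball (0 : E) R,
      ∀ j, ∑ i ∈ univ.filter (fun i => dist i j ≠ 0), ‖P σ u i j‖ ≤ h)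
    (hacc : ∀ σ : TPt d N' → ℂ, (∀ j, ‖σ j‖ ≤ Real.exp c.κ₁) → ∀ u ∈ ball (0 : E) R,
      ∀ v : Λ → ℂ, m * ∑ i, ‖v i‖ ^ 2 ≤ (∑ i, star (v i) * (P σ u *ᵥ v) i).re)
    (hPloc : ∀ σ : TPt d N' → ℂ, (∀ j, ‖σ j‖ ≤ Real.exp c.κ₁) →
      ∀ k l, ‖(P σ 0 - P 0 0) k l‖ ≤ B₀ * Real.exp (-(ρ₀ * distX X (locΛ k) (locΛ l))))
    (hPholo : ∀ σ : TPt d N' → ℂ, (∀ j, ‖σ j‖ ≤ Real.exp c.κ₁) →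
      ∀ i j, DifferentiableOn ℂ (fun u => P σ u i j) (ball (0 : E) R))
    (hvol : ∀ i, ∑ k, Real.exp (-(η * dist i k)) ≤ cV) (hvol' : ∀ j, ∑ l, Real.exp (-(η * dist l j)) ≤ cV) :
    KernelLetters c locΛ locΛ (fun σ u => invSqrt (P σ u)) X R (θ' / s) (2 / Real.sqrt m)
      (4 * B₀ * cV ^ 2 / (m * Real.sqrt m)) := by
  have h0ball : (0 : E) ∈ ball (0 : E) R := mem_ball_self hR
  have h0pd := zero_mem_polydisc (d := d) (N' := N') c
  have hsne : s ≠ 0 := hs.ne'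
  -- rate comparison: `(θ'/s)·d₁(loc i, loc j) ≤ θ·dist i j`
  have hrate : ∀ i j, θ' / s * tdist1 Nf (locΛ i) (locΛ j) ≤ θ * (dist i j : ℝ) := by
    intro i j
    have hθ'θ : θ' ≤ θ := by linarith
    have hdij : (0 : ℝ) ≤ dist i j := Nat.cast_nonneg _
    calc θ' / s * tdist1 Nf (locΛ i) (locΛ j) ≤ θ' / s * (s * dist i j) :=
          mul_le_mul_of_nonneg_left (hloc i j) (div_nonneg hθ' hs.le)
      _ = θ' * dist i j := by field_simp
      _ ≤ θ * dist i j := mul_le_mul_of_nonneg_right hθ'θ hdij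
  refine ⟨?_, ?_, ?_, div_nonneg zero_le_two (Real.sqrt_nonneg _), by positivity⟩
  · -- (L1) decay
    intro σ hσ u hu i j
    have h1 := norm_invSqrt_apply_le dist hd0 hds hdt (P σ u) (hrange σ hσ u hu) h (hrow σ hσ u hu) (hcol σ hσ u hu)
      m θ hm hθ (hacc σ hσ u hu) hhθ i j
    refine h1.trans (mul_le_mul_of_nonneg_left (Real.exp_le_exp.2 (neg_le_neg (hrate i j))) ?_)
    exact div_nonneg zero_le_two (Real.sqrt_nonneg _)
  · -- (L2) σ-localisation through `X`, weight `D := d_X(loc ·, loc ·)/s`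
    intro σ hσ i j
    set D : Λ → Λ → ℝ := fun k l => distX X (locΛ k) (locΛ l) / s with hDdef
    have hD0 : ∀ k l, 0 ≤ D k l := fun k l => div_nonneg (distX_nonneg X _ _) hs.le
    have hD : ∀ i k l j, D i j ≤ dist i k + D k l + dist l j := by
      intro i k l j
      have h1 := distX_le_tdist1_add hX (locΛ i) (locΛ k) (locΛ l) (locΛ j)
      have h2 : distX X (locΛ i) (locΛ j) ≤ s * dist i k + distX X (locΛ k) (locΛ l) + s * dist l j := by
        linarith [hloc i k, hloc l j]
      have h3 : distX X (locΛ i) (locΛ j) / s ≤ (s * dist i k + distX X (locΛ k) (locΛ l) + s * dist l j) / s :=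
        div_le_div_of_nonneg_right h2 hs.le
      calc D i j = distX X (locΛ i) (locΛ j) / s := rfl
        _ ≤ (s * dist i k + distX X (locΛ k) (locΛ l) + s * dist l j) / s := h3
        _ = dist i k + D k l + dist l j := by simp only [hDdef]; field_simp
    have hE : ∀ k l, ‖(P σ 0 - P 0 0) k l‖ ≤ B₀ * Real.exp (-(ρ₀ * s * D k l)) := by
      intro k l
      have : ρ₀ * s * D k l = ρ₀ * distX X (locΛ k) (locΛ l) := by simp only [hDdef]; field_simp
      rw [this]
      exact hPloc σ hσ k l
    have h2 := norm_invSqrt_sub_apply_le dist hd0 hds hdt (P σ 0) (P 0 0) (hrange σ hσ 0 h0ball) (hrange 0 h0pd 0 h0ball) h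
      (hrow σ hσ 0 h0ball) (hcol σ hσ 0 h0ball) (hrow 0 h0pd 0 h0ball) (hcol 0 h0pd 0 h0ball) m θ hm hθ (hacc σ hσ 0 h0ball)
      (hacc 0 h0pd 0 h0ball) hhθ D hD0 hD (B := B₀) (ρ := ρ₀ * s) (η := η) (θ' := θ') (cV := cV) hB₀ hθ' hθ'ρ hθ'η hE hvol hvol' i j
    have hexp : Real.exp (-(θ' * D i j)) = Real.exp (-(θ' / s * distX X (locΛ i) (locΛ j))) := by
      congr 1; simp only [hDdef]; field_simp
    rw [← Matrix.sub_apply, ← hexp]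
    exact h2
  · -- (L3) holomorphy in the background
    intro σ hσ i j
    exact differentiableOn_invSqrt_apply (fun u => P σ u) hm (fun u hu => hacc σ hσ u hu) (hPholo σ hσ) i j

/-! ## §3 Letters of a PRODUCT of two letter-carrying families (the Γ-kernel as «local factor × square root») -/

section Product

variable {p q n : Type} [Fintype q]

/-- Splitting one decaying factor: `e^{−ρ(a+b)} ≤ e^{−ρ′x}·e^{−ηa}` whenever `x ≤ a + b`, `0 ≤ a, b`, `0 ≤ ρ′`, `0 ≤ η`, `ρ′ + η ≤ ρ` (plumbing). [folklore] -/
private theorem exp_split {ρ ρ' η a b x : ℝ} (hρ' : 0 ≤ ρ') (hη : 0 ≤ η) (hsplit : ρ' + η ≤ ρ) (ha : 0 ≤ a) (hb : 0 ≤ b)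
    (hx : x ≤ a + b) :
    Real.exp (-(ρ * a)) * Real.exp (-(ρ * b)) ≤ Real.exp (-(ρ' * x)) * Real.exp (-(η * a)) := by
  rw [← Real.exp_add, ← Real.exp_add]
  apply Real.exp_le_exp.2
  nlinarith [mul_le_mul_of_nonneg_left hx hρ', mul_nonneg hη hb, mul_nonneg (sub_nonneg.2 hsplit) (add_nonneg ha hb)]

/-- **LETTERS OF A PRODUCT**: if `K₁(σ,u) : p × q` and `K₂(σ,u) : q × n` both carry NODE O's letters (L1)–(L3) through the same `X` at rate `ρ` on the
`R`-ball (`R > 0`), and the middle index set has volume sums `Σ_k e^{−η d₁(loc i, loc k)} ≤ c_V` (rows of `p`, columns of `n`), then the product family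
`(σ,u) ↦ K₁(σ,u)·K₂(σ,u)` carries (L1)–(L3) through `X` at any rate `ρ′ ≥ 0` with `ρ′ + η ≤ ρ`, amplitudes `B₁B₂c_V` and `(B₁′B₂ + B₁B₂′)c_V`
(decay: triangle inequality for `d₁`; σ-localisation: `K₁K₂(σ,0) − K₁K₂(0,0) = (K₁(σ,0) − K₁(0,0))K₂(σ,0) + K₁(0,0)(K₂(σ,0) − K₂(0,0))` and the
through-domination of `d_X` (§1); holomorphy: finite sums of products).  With §2 this reduces the Γ-kernel's letters, read as «local factor × square root of
the covariance» (p. 13), to letters of the local factor and of the precision. [cite: Balaban1988RG2Cluster, p.13, p.15, (2.16) p.16; Balaban1985BackgroundPropagators, (3.93) p.410] -/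
theorem kernelLetters_mul (c : B13.Consts) {locp : p → UT Nf} {locq : q → UT Nf} {locn : n → UT Nf}
    {K₁ : (TPt d N' → ℂ) → E → Matrix p q ℂ} {K₂ : (TPt d N' → ℂ) → E → Matrix q n ℂ} {X : Finset (UT Nf)} (hX : X.Nonempty)
    {R ρ ρ' η B₁ B₁' B₂ B₂' cV : ℝ} (hR : 0 < R) (hρ' : 0 ≤ ρ') (hη : 0 ≤ η) (hsplit : ρ' + η ≤ ρ) (hcV : 0 ≤ cV)
    (h₁ : KernelLetters c locp locq K₁ X R ρ B₁ B₁') (h₂ : KernelLetters c locq locn K₂ X R ρ B₂ B₂')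
    (hvol : ∀ i : p, ∑ k : q, Real.exp (-(η * tdist1 Nf (locp i) (locq k))) ≤ cV)
    (hvol' : ∀ j : n, ∑ k : q, Real.exp (-(η * tdist1 Nf (locq k) (locn j))) ≤ cV) :
    KernelLetters c locp locn (fun σ u => K₁ σ u * K₂ σ u) X R ρ' (B₁ * B₂ * cV) ((B₁' * B₂ + B₁ * B₂') * cV) := by
  have h0ball : (0 : E) ∈ ball (0 : E) R := mem_ball_self hR
  have h0pd := zero_mem_polydisc (d := d) (N' := N') c
  have hB₁ := h₁.B_nonneg; have hB₂ := h₂.B_nonneg; have hB₁' := h₁.B'_nonneg; have hB₂' := h₂.B'_nonneg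
  -- the generic convolution step: a sum of products of two decaying factors
  have conv : ∀ (a : q → ℝ) (b : q → ℝ) (x A Bc : ℝ) (vol : q → ℝ), 0 ≤ A → 0 ≤ Bc →
      (∀ k, 0 ≤ a k) → (∀ k, 0 ≤ b k) → (∀ k, x ≤ a k + b k) → (∀ k, vol k = Real.exp (-(η * a k)) ∨ vol k = Real.exp (-(η * b k))) →
      (∀ k, Real.exp (-(ρ * a k)) * Real.exp (-(ρ * b k)) ≤ Real.exp (-(ρ' * x)) * vol k) →
      ∑ k, vol k ≤ cV →
      ∑ k, A * Real.exp (-(ρ * a k)) * (Bc * Real.exp (-(ρ * b k))) ≤ A * Bc * cV * Real.exp (-(ρ' * x)) := by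
    intro a b x A Bc vol hA hBc ha hb hx _ hstep hsum
    calc ∑ k, A * Real.exp (-(ρ * a k)) * (Bc * Real.exp (-(ρ * b k)))
        = A * Bc * ∑ k, Real.exp (-(ρ * a k)) * Real.exp (-(ρ * b k)) := by rw [Finset.mul_sum]; exact Finset.sum_congr rfl fun k _ => by ring
      _ ≤ A * Bc * ∑ k, Real.exp (-(ρ' * x)) * vol k :=
          mul_le_mul_of_nonneg_left (Finset.sum_le_sum fun k _ => hstep k) (mul_nonneg hA hBc)
      _ = A * Bc * Real.exp (-(ρ' * x)) * ∑ k, vol k := by rw [← Finset.mul_sum]; ring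
      _ ≤ A * Bc * Real.exp (-(ρ' * x)) * cV :=
          mul_le_mul_of_nonneg_left hsum (mul_nonneg (mul_nonneg hA hBc) (Real.exp_pos _).le)
      _ = A * Bc * cV * Real.exp (-(ρ' * x)) := by ring
  refine ⟨?_, ?_, ?_, by positivity, by positivity⟩
  · -- (L1) decay of the product
    intro σ hσ u hu i j
    rw [Matrix.mul_apply]
    calc ‖∑ k, K₁ σ u i k * K₂ σ u k j‖ ≤ ∑ k, ‖K₁ σ u i k * K₂ σ u k j‖ := norm_sum_le _ _
      _ ≤ ∑ k, B₁ * Real.exp (-(ρ * tdist1 Nf (locp i) (locq k))) * (B₂ * Real.exp (-(ρ * tdist1 Nf (locq k) (locn j)))) :=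
          Finset.sum_le_sum fun k _ => (norm_mul_le _ _).trans
            (mul_le_mul (h₁.decay σ hσ u hu i k) (h₂.decay σ hσ u hu k j) (norm_nonneg _)
              (mul_nonneg hB₁ (Real.exp_pos _).le))
      _ ≤ B₁ * B₂ * cV * Real.exp (-(ρ' * tdist1 Nf (locp i) (locn j))) :=
          conv (fun k => tdist1 Nf (locp i) (locq k)) (fun k => tdist1 Nf (locq k) (locn j)) _ B₁ B₂
            (fun k => Real.exp (-(η * tdist1 Nf (locp i) (locq k)))) hB₁ hB₂ (fun k => tdist1_nonneg _ _)
            (fun k => tdist1_nonneg _ _) (fun k => tdist1_triangle _ _ _) (fun k => Or.inl rfl)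
            (fun k => exp_split hρ' hη hsplit (tdist1_nonneg _ _) (tdist1_nonneg _ _) (tdist1_triangle _ _ _)) (hvol i)
  · -- (L2) σ-localisation of the product through `X`
    intro σ hσ i j
    have hsplitM : K₁ σ 0 * K₂ σ 0 - K₁ 0 0 * K₂ 0 0 = (K₁ σ 0 - K₁ 0 0) * K₂ σ 0 + K₁ 0 0 * (K₂ σ 0 - K₂ 0 0) := by
      rw [Matrix.sub_mul, Matrix.mul_sub]; abel
    have hT₁ : ‖((K₁ σ 0 - K₁ 0 0) * K₂ σ 0) i j‖ ≤ B₁' * B₂ * cV * Real.exp (-(ρ' * distX X (locp i) (locn j))) := by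
      rw [Matrix.mul_apply]
      calc ‖∑ k, (K₁ σ 0 - K₁ 0 0) i k * K₂ σ 0 k j‖ ≤ ∑ k, ‖(K₁ σ 0 - K₁ 0 0) i k * K₂ σ 0 k j‖ := norm_sum_le _ _
        _ ≤ ∑ k, B₁' * Real.exp (-(ρ * distX X (locp i) (locq k))) * (B₂ * Real.exp (-(ρ * tdist1 Nf (locq k) (locn j)))) :=
            Finset.sum_le_sum fun k _ => (norm_mul_le _ _).trans
              (mul_le_mul (by simpa [Matrix.sub_apply] using h₁.sigmaLoc σ hσ i k) (h₂.decay σ hσ 0 h0ball k j) (norm_nonneg _)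
                (mul_nonneg hB₁' (Real.exp_pos _).le))
        _ ≤ B₁' * B₂ * cV * Real.exp (-(ρ' * distX X (locp i) (locn j))) :=
            conv (fun k => distX X (locp i) (locq k)) (fun k => tdist1 Nf (locq k) (locn j)) _ B₁' B₂
              (fun k => Real.exp (-(η * tdist1 Nf (locq k) (locn j)))) hB₁' hB₂ (fun k => distX_nonneg X _ _)
              (fun k => tdist1_nonneg _ _)
              (fun k => by simpa [B9Thm37GlueTorus.tdist1_self] using distX_le_tdist1_add hX (locp i) (locp i) (locq k) (locn j))
              (fun k => Or.inr rfl)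
              (fun k => by
                have hx : distX X (locp i) (locn j) ≤ tdist1 Nf (locq k) (locn j) + distX X (locp i) (locq k) := by
                  have := distX_le_tdist1_add hX (locp i) (locp i) (locq k) (locn j)
                  rw [B9Thm37GlueTorus.tdist1_self, zero_add] at this
                  linarith
                have h := exp_split hρ' hη hsplit (tdist1_nonneg (locq k) (locn j)) (distX_nonneg X (locp i) (locq k)) hx
                rw [mul_comm (Real.exp (-(ρ * distX X (locp i) (locq k))))]
                exact h)
              (hvol' j)
    have hT₂ : ‖(K₁ 0 0 * (K₂ σ 0 - K₂ 0 0)) i j‖ ≤ B₁ * B₂' * cV * Real.exp (-(ρ' * distX X (locp i) (locn j))) := by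
      rw [Matrix.mul_apply]
      calc ‖∑ k, K₁ 0 0 i k * (K₂ σ 0 - K₂ 0 0) k j‖ ≤ ∑ k, ‖K₁ 0 0 i k * (K₂ σ 0 - K₂ 0 0) k j‖ := norm_sum_le _ _
        _ ≤ ∑ k, B₁ * Real.exp (-(ρ * tdist1 Nf (locp i) (locq k))) * (B₂' * Real.exp (-(ρ * distX X (locq k) (locn j)))) :=
            Finset.sum_le_sum fun k _ => (norm_mul_le _ _).trans
              (mul_le_mul (h₁.decay 0 h0pd 0 h0ball i k) (by simpa [Matrix.sub_apply] using h₂.sigmaLoc σ hσ k j) (norm_nonneg _)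
                (mul_nonneg hB₁ (Real.exp_pos _).le))
        _ ≤ B₁ * B₂' * cV * Real.exp (-(ρ' * distX X (locp i) (locn j))) :=
            conv (fun k => tdist1 Nf (locp i) (locq k)) (fun k => distX X (locq k) (locn j)) _ B₁ B₂'
              (fun k => Real.exp (-(η * tdist1 Nf (locp i) (locq k)))) hB₁ hB₂' (fun k => tdist1_nonneg _ _)
              (fun k => distX_nonneg X _ _)
              (fun k => by simpa [B9Thm37GlueTorus.tdist1_self] using distX_le_tdist1_add hX (locp i) (locq k) (locn j) (locn j))
              (fun k => Or.inl rfl)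
              (fun k => exp_split hρ' hη hsplit (tdist1_nonneg _ _) (distX_nonneg X _ _)
                (by simpa [B9Thm37GlueTorus.tdist1_self] using distX_le_tdist1_add hX (locp i) (locq k) (locn j) (locn j)))
              (hvol i)
    calc ‖(K₁ σ 0 * K₂ σ 0) i j - (K₁ 0 0 * K₂ 0 0) i j‖ = ‖(K₁ σ 0 * K₂ σ 0 - K₁ 0 0 * K₂ 0 0) i j‖ := by rw [Matrix.sub_apply]
      _ = ‖((K₁ σ 0 - K₁ 0 0) * K₂ σ 0 + K₁ 0 0 * (K₂ σ 0 - K₂ 0 0)) i j‖ := by rw [hsplitM]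
      _ ≤ ‖((K₁ σ 0 - K₁ 0 0) * K₂ σ 0) i j‖ + ‖(K₁ 0 0 * (K₂ σ 0 - K₂ 0 0)) i j‖ := by
          rw [Matrix.add_apply]; exact norm_add_le _ _
      _ ≤ B₁' * B₂ * cV * Real.exp (-(ρ' * distX X (locp i) (locn j))) + B₁ * B₂' * cV * Real.exp (-(ρ' * distX X (locp i) (locn j))) :=
          add_le_add hT₁ hT₂
      _ = (B₁' * B₂ + B₁ * B₂') * cV * Real.exp (-(ρ' * distX X (locp i) (locn j))) := by ring
  · -- (L3) holomorphy of the product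
    intro σ hσ i j
    have hfun : (fun u => (K₁ σ u * K₂ σ u) i j) = fun u => ∑ k, K₁ σ u i k * K₂ σ u k j := by
      funext u; rw [Matrix.mul_apply]
    rw [hfun]
    exact DifferentiableOn.fun_sum fun k _ => (h₁.holo σ hσ i k).mul (h₂.holo σ hσ k j)

end Product

end Literature.MathematicalPhysics.QuantumFieldTheory.Balaban1983to89.NodeOLettersSqrt

end
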